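import Summits.BirchSwinnertonDyer.BirchSwinnertonDyer.Theorems.KolyvaginDepthDoorDepthTableRowKitPrint
import HarnessLib

/-!
# Route `KolyvaginDepthDoor` — the DEPTH-TWO (rank-3) ROW KIT ON PRINT-STANDARD INPUTS: (γ) [Gross 1991
# Prop. 3.7 (2)] + a Kodaira–Néron certificate read off the integer model; no McCallum leaf, no F1
# (crux `KolyvaginDepthSupply`, stmt-BirchSwinnertonDyer-21765)

Helper file (`--supports stmt-BirchSwinnertonDyer-21765 --as helper`); it closes nothing and BSD is
not proved by it.

g7's `depthRowTwo_noTwist_of_datum_of_intModel_certificate` (file `…RowKitNoTwistDepthTwoOfDatum`) reads a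
rank-3 depth-2 row modulo the FIVE named McCallum / Gross leaves; `…LeavesOfPrint` (this seat) feeds
them from (γ) + F1. THIS kit drops F1 too, for curves on the Kodaira–Néron cell: it runs the any-depth
door `shaCorank_eq_zero_of_kolyvaginClass_ne_zero_of_rank_le_of_datum_kodairaNeron` (`…DoorOfDatumPrint`)
at `n = ℓ₁ℓ₂` with (KN_p) CERTIFIED from `Δ(E₀)` by `not_dvd_ordMinimalDiscriminant_of_intModel_table`
(`…DepthTableRowKitPrint`). Output: `t_p = 0`, `rank = 3`, `rank E^{(D)} ≤ 2`, `E(ℚ)[p] = 0`,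
`Ш(E/ℚ)[p] = 0`, `#Sel_p(E/ℚ) = p³` (the twist-Selmer count `#Sel_p(E^{(D)}) ≤ p²` of g7's kit is not
re-derived here; it is available modulo (γ) + F1 from `depthRowTwo_print_of_datum_of_intModel_certificate`).

* `depthRowTwo_print_kodairaNeron_of_datum_of_intModel_certificate` — THE KIT. CONDITIONAL on (γ) and the
  depth-2 bit; per-curve; BSD is not proved by it.

References: [Kolyvagin1991MathAnn] Thm. 2.3; [GrossLMS1991] Prop. 3.7 (2), §§3–6, §10;
[McCallumLMS1991] §§2–5; [SilvermanAEC2009] VII.6.1; [WZhang2014] Notations (xii).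
-/

set_option linter.dupNamespace false

noncomputable section

open scoped Classical NumberField

namespace Summit.BirchSwinnertonDyer.BirchSwinnertonDyer.Theorems.KolyvaginDepthDoor

open Literature.NumberTheory.EllipticCurves Literature.NumberTheory.EllipticCurves.ModularForms
  Literature.NumberTheory.EllipticCurves.McCallum1991 WeierstrassCurve NumberField IsDedekindDomain
open Literature.NumberTheory.DiophantineGeometry (KodairaSymbol)

section Generic

variable {W : WeierstrassCurve ℚ} [W.IsElliptic] [W.IsGloballyMinimal] {E₀ : WeierstrassCurve ℤ}
  (hI : integralModelInt W = E₀)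
include hI

/-- **The rank-3 depth-2 row off an integer model on (γ) + a Kodaira–Néron certificate** (no McCallum
leaf, no F1): inputs = g7's integer-model certificate of the row (two Kolyvagin primes `ℓ₁ ≠ ℓ₂`,
`3 ≤ rank`), (γ), the `decide`-able (KN_p) table of `Δ(E₀)`, and ONE datum `d` of conductor `ℓ₁ℓ₂` with
its bit. [cite: Kolyvagin1991MathAnn, Thm. 2.3] [cite: GrossLMS1991, Prop. 3.7 (2), Prop. 6.2 (1)]
[cite: McCallumLMS1991, §§2–5] [cite: SilvermanAEC2009, VII.6.1] [cite: WZhang2014, Notations (xii)] -/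
theorem depthRowTwo_print_kodairaNeron_of_datum_of_intModel_certificate
    (h372 : GrossLMS1991.prop37_2_frobeniusCongruence)
    (hcm : ¬ W.HasCM) (hr : 3 ≤ W.mordellWeilRank)
    (p : ℕ) [hp : Fact p.Prime] (hp2 : p ≠ 2)
    (htower : ∀ n : ℕ, W.HasSurjectiveModNGaloisRep (p ^ n : ℕ))
    (K : Type) [Field K] [NumberField K] (hK : IsImaginaryQuadratic K) {D : ℤ}
    (hD : NumberField.discr K = D) (h3 : D ≠ -3) (h4 : D ≠ -4)
    (hH : ∀ q : ℕ, q.Prime → (q : ℤ) ∣ E₀.Δ → (q = 2 → D % 8 = 1) ∧ (q ≠ 2 → jacobiSym D q = 1))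
    (ℓ₁ : ℕ) (hℓ₁ : ℓ₁.Prime) (hℓ₁2 : ℓ₁ ≠ 2) (hℓ₁Δ : ¬ (ℓ₁ : ℤ) ∣ E₀.Δ) (hℓ₁D : ¬ (ℓ₁ : ℤ) ∣ D)
    (hℓ₁p : ℓ₁ ≠ p) (hjac₁ : jacobiSym D ℓ₁ = -1) (hℓ₁1 : p ∣ ℓ₁ + 1) {n₁ : ℕ}
    (hcard₁ : Nat.card ((E₀.map (Int.castRingHom (ZMod ℓ₁))).toAffine.Point) = n₁)
    (haℓ₁ : (p : ℤ) ∣ (ℓ₁ : ℤ) + 1 - n₁)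
    (ℓ₂ : ℕ) (hℓ₂ : ℓ₂.Prime) (hℓ₂2 : ℓ₂ ≠ 2) (hℓ₂Δ : ¬ (ℓ₂ : ℤ) ∣ E₀.Δ) (hℓ₂D : ¬ (ℓ₂ : ℤ) ∣ D)
    (hℓ₂p : ℓ₂ ≠ p) (hjac₂ : jacobiSym D ℓ₂ = -1) (hℓ₂1 : p ∣ ℓ₂ + 1) {n₂ : ℕ}
    (hcard₂ : Nat.card ((E₀.map (Int.castRingHom (ZMod ℓ₂))).toAffine.Point) = n₂)
    (haℓ₂ : (p : ℤ) ∣ (ℓ₂ : ℤ) + 1 - n₂) (hℓℓ : ℓ₁ ≠ ℓ₂)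
    {Δ₀ : ℤ} (hΔ : E₀.Δ = Δ₀) {B : ℕ} (hB : Δ₀.natAbs < B ^ p)
    (htab : ∀ q ∈ Finset.range B, q.Prime → q ∣ Δ₀.natAbs →
      ∃ e ∈ Finset.range 64, q ^ e ∣ Δ₀.natAbs ∧ ¬ q ^ (e + 1) ∣ Δ₀.natAbs ∧ ¬ p ∣ e)
    (hadd : ∀ v : HeightOneSpectrum (𝓞 ℚ), W.HasAdditiveReductionAt v → p ≠ 3 ∨
      (W.kodairaSymbolAt v ≠ KodairaSymbol.IV ∧ W.kodairaSymbolAt v ≠ KodairaSymbol.IVstar))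
    [NeZero (W.conductorNorm ℤ)] (Dt : ModularParametrizationData W (W.conductorNorm ℤ)) (β : ℤ)
    (ι : K →+* ℂ) (d : KolyvaginHeegnerData Dt β ι (ℓ₁ * ℓ₂))
    (hne : d.kolyvaginClass hp.out 1 ≠ 0) :
    W.shaCorank p = 0 ∧ W.mordellWeilRank = 3 ∧ (W.quadraticTwist (D : ℚ)).mordellWeilRank ≤ 2 ∧
      (∀ P : W.toAffine.Point, p • P = 0 → P = 0) ∧ (∀ c ∈ W.sha, p • c = 0 → c = 0) ∧
      Nat.card ↥(selmerGroup W (p : ℤ)) = p ^ 3 := by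
  obtain ⟨hkol₁, -⟩ := isKolyvaginPrime_of_intModel_certificate hI p K hK.1 hD ℓ₁ hℓ₁ hℓ₁2 hℓ₁Δ hℓ₁D
    hℓ₁p hjac₁ hℓ₁1 hcard₁ haℓ₁
  obtain ⟨hkol₂, -⟩ := isKolyvaginPrime_of_intModel_certificate hI p K hK.1 hD ℓ₂ hℓ₂ hℓ₂2 hℓ₂Δ hℓ₂D
    hℓ₂p hjac₂ hℓ₂1 hcard₂ haℓ₂
  obtain ⟨c, hc, hcc⟩ := exists_conj_of_isImaginaryQuadratic K hK
  have hH' := satisfiesHeegnerHypothesis_conductorNorm_of_intModel hI K hK.1 hD hH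
  have hmult : ∀ v : HeightOneSpectrum (𝓞 ℚ), W.HasMultiplicativeReductionAt v →
      ¬ p ∣ W.ordMinimalDiscriminant v :=
    not_dvd_ordMinimalDiscriminant_of_intModel_table hI hΔ hB htab
  -- `n = ℓ₁ℓ₂` is a square-free product of two Kolyvagin primes
  have hcop : ℓ₁.Coprime ℓ₂ := (Nat.coprime_primes hℓ₁ hℓ₂).mpr hℓℓ
  have hsq : Squarefree (ℓ₁ * ℓ₂) :=
    Nat.squarefree_mul_iff.mpr ⟨hcop, hℓ₁.squarefree, hℓ₂.squarefree⟩
  have hpf : (ℓ₁ * ℓ₂).primeFactors = {ℓ₁, ℓ₂} := by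
    rw [Nat.Coprime.primeFactors_mul hcop, hℓ₁.primeFactors, hℓ₂.primeFactors]
    rfl
  have hcard : (ℓ₁ * ℓ₂).primeFactors.card = 2 := by
    rw [hpf, Finset.card_insert_of_notMem (by rw [Finset.mem_singleton]; exact hℓℓ),
      Finset.card_singleton]
  have hk : ∀ q ∈ (ℓ₁ * ℓ₂).primeFactors, Zhang2014.IsKolyvaginPrime (W.conductorNorm ℤ) W K p q := by
    intro q hq
    rw [hpf, Finset.mem_insert, Finset.mem_singleton] at hq
    rcases hq with rfl | rfl
    · exact hkol₁
    · exact hkol₂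
  obtain ⟨hsha, hrk, hr', ht, hbot, hSel⟩ :=
    shaCorank_eq_zero_of_kolyvaginClass_ne_zero_of_rank_le_of_datum_kodairaNeron h372 hcm hK
      (by rw [hD]; exact h3) (by rw [hD]; exact h4) hH' p hp2 htower c hc hcc hmult hadd hsq hk d hne
      (by rw [hcard]; exact hr)
  rw [hcard] at hrk hr' hSel
  rw [pow_one] at ht hbot hSel
  rw [hD] at hr'
  refine ⟨hsha, hrk, hr', fun P hP ↦ ?_, fun x hx hpx ↦ ?_, hSel⟩
  · have hmem : P ∈ AddSubgroup.torsionBy W.toAffine.Point (p : ℤ) :=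
      AddSubgroup.torsionBy.nsmul_iff.mpr hP
    rw [AddSubgroup.card_eq_one.mp ht] at hmem
    exact (AddSubgroup.mem_bot).mp hmem
  · have hmem : x ∈ W.sha ⊓ AddSubgroup.torsionBy W.galH1 (p : ℤ) :=
      AddSubgroup.mem_inf.mpr ⟨hx, AddSubgroup.torsionBy.nsmul_iff.mpr hpx⟩
    rw [hbot] at hmem
    exact (AddSubgroup.mem_bot).mp hmem

end Generic

end Summit.BirchSwinnertonDyer.BirchSwinnertonDyer.Theorems.KolyvaginDepthDoor

end
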